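import Summits.NavierStokesRegularity.NavierStokesRegularity.Theses.QuantisedSymmetry
import Summits.NavierStokesRegularity.NavierStokesRegularity.Theses.Blowup
import Summits.NavierStokesRegularity.NavierStokesRegularity.Theorems.QuantisedSymmetryPolyhedralTruncationBridge
import Summits.NavierStokesRegularity.NavierStokesRegularity.Theorems.QuantisedSymmetryPolyhedralDssProfileExistsCellOfProfile
import Summits.NavierStokesRegularity.NavierStokesRegularity.Theorems.QuantisedSymmetryPolyhedralDssProfileExistsDominatesBlowupProfile
import Summits.NavierStokesRegularity.NavierStokesRegularity.Theorems.QuantisedSymmetryLiouvilleKillsProfile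
import Summits.NavierStokesRegularity.NavierStokesRegularity.Theorems.QuantisedSymmetryPolyhedralDssProfileExistsNoSmallCell
import Summits.NavierStokesRegularity.NavierStokesRegularity.Theorems.QuantisedSymmetryPolyhedralDssProfileExistsStubNoSmallConstant
import Summits.NavierStokesRegularity.NavierStokesRegularity.Theorems.QuantisedSymmetryPolyhedralDssProfileExistsStubNoWeakHealing
import HarnessLib

/-!
# Strategist sketch s18-g8 — crux `PolyhedralDssProfileExists` (stmt-NavierStokesRegularity-1404)

Companion to `STRATEGY-CENSUS-s18.md` (independent census family `s`, gen 8). Kernel-checked, no `sorry`.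
It certifies, BY NAME over landed declarations only:

* §0 `crux_decides` — the crux ALONE decides the sub-problem (`¬ NavierStokesRegularity`) through the landed
  bridge `quantisedSymmetry_polyhedralTruncationBridge_proof` and `ClayUniqueness_holds`: the crux is summit-bearing.
* §1 summit-down intermediates — every strictly weaker ON-PATH replacement of the crux that the tree can type
  (`W₁ = Blowup.BlowupTypeIDssProfile`, `WRot` = rotated-DSS profile, `X5a = Blowup.BlowupExists`) is itself
  summit-deciding by landed theorems (`W1_decides`, `WRot_decides`, `X5a_decides`): replacing X by any of them is a
  re-glue onto another route's crux, not a strategy short of the summit.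
* §2 off-path weakenings `WTypeI` (= ¬ kill switch), `WBdd` (cell without the `L⁴` datum) with the crux ⇒ them, and
  the typed decomposition `crux_of_WBdd_upgrade : WBdd → BddUpgrade → X` (assembly proved; the upgrade piece is a
  decay/Liouville statement).
* §3 the Newton–Kantorovich decomposition `crux_of_certificate : NKCertificate → NewtonKantorovich → X`
  (assembly proved; `NewtonKantorovich` is the classical theorem, `NKCertificate` carries the whole ∃-content).
* §4 strengthening `BranchInC` (a whole branch of cells parametrised by the factor) ⇒ X.
* §5 negation side: `negation_is_killSwitch : PolyhedralTypeILiouville → ¬ X` (landed glue 1408) and the landed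
  small-data / healing exclusions referenced by name.
-/

namespace Summit.NavierStokesRegularity.NavierStokesRegularity.Cruxes.PolyhedralDssProfileExists.StrategistS18g8

open MeasureTheory
open Literature.Analysis.FluidPDE
open Summit.NavierStokesRegularity.NavierStokesRegularity.Theses
open Summit.NavierStokesRegularity.NavierStokesRegularity.Theorems
open Summit.NavierStokesRegularity.NavierStokesRegularity.Theorems.PolyhedralDssProfileExists.PolyhedralCell

noncomputable section

/-! ## Local abbreviations (verbatim sub-formulae of the route file / line `polyhedral_cell`) -/

/-- `G` is a finite group of proper rotations of `ℝ³` acting irreducibly (the crux's group clause). -/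
def IsPolyhedral (G : Subgroup (EuclideanSpace ℝ (Fin 3) ≃ₗᵢ[ℝ] EuclideanSpace ℝ (Fin 3))) : Prop :=
  Finite G ∧
  (∀ g ∈ G, LinearMap.det (g.toLinearEquiv : EuclideanSpace ℝ (Fin 3) →ₗ[ℝ] EuclideanSpace ℝ (Fin 3)) = 1) ∧
  (∀ V : Submodule ℝ (EuclideanSpace ℝ (Fin 3)), (∀ g ∈ G, ∀ v ∈ V, g v ∈ V) → V = ⊥ ∨ V = ⊤)

/-- The polyhedral-cell body of line `polyhedral_cell` (verbatim from `stub_profileOfPolyhedralCell`): a jointly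
continuous, bounded, weakly divergence-free, Oseen-mild `G`-equivariant field on the model period `[-1,-c⁻²]`
closing up under the zoom. -/
def IsCell (G : Subgroup (EuclideanSpace ℝ (Fin 3) ≃ₗᵢ[ℝ] EuclideanSpace ℝ (Fin 3))) (c : ℝ)
    (v : ℝ → EuclideanSpace ℝ (Fin 3) → EuclideanSpace ℝ (Fin 3)) : Prop :=
  ContinuousOn (Function.uncurry v) (Set.Icc (-1 : ℝ) (-(c ^ 2)⁻¹) ×ˢ Set.univ) ∧
  (∃ M : ℝ, ∀ t ∈ Set.Icc (-1 : ℝ) (-(c ^ 2)⁻¹), ∀ x, ‖v t x‖ ≤ M) ∧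
  (∀ t ∈ Set.Icc (-1 : ℝ) (-(c ^ 2)⁻¹), IsWeaklyDivFree (v t)) ∧
  (∀ s t : ℝ, -1 ≤ s → s < t → t ≤ -(c ^ 2)⁻¹ → ∀ x,
    v t x = heatFlow (v s) (t - s) x - oseenDuhamel 1 s v v t x) ∧
  (∀ x, v (-(c ^ 2)⁻¹) x = c • v (-1) (c • x)) ∧
  (∀ g ∈ G, ∀ t ∈ Set.Icc (-1 : ℝ) (-(c ^ 2)⁻¹), ∀ x, v t (g x) = g (v t x))

/-- `CellExists` — the body of the line's one open stub `stub_polyhedralCellExists`. -/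
def CellExists : Prop :=
  ∃ G : Subgroup (EuclideanSpace ℝ (Fin 3) ≃ₗᵢ[ℝ] EuclideanSpace ℝ (Fin 3)), IsPolyhedral G ∧
    ∃ c : ℝ, 1 < c ∧ ∃ v : ℝ → EuclideanSpace ℝ (Fin 3) → EuclideanSpace ℝ (Fin 3),
      IsCell G c v ∧ MemLp (v (-1)) 4 volume ∧ ¬ (v (-1) =ᵐ[volume] 0)

/-- Landed equivalence crux ↔ cell (`polyhedralDssProfileExists_iff_cell`), restated over the abbreviations. -/
theorem crux_iff_cell : QuantisedSymmetry.PolyhedralDssProfileExists ↔ CellExists := by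
  rw [polyhedralDssProfileExists_iff_cell]
  constructor
  · rintro ⟨G, hfin, hdet, hirr, c, hc, v, hcell, hL4, hnt⟩
    exact ⟨G, ⟨hfin, hdet, hirr⟩, c, hc, v, hcell, hL4, hnt⟩
  · rintro ⟨G, ⟨hfin, hdet, hirr⟩, c, hc, v, hcell, hL4, hnt⟩
    exact ⟨G, hfin, hdet, hirr, c, hc, v, hcell, hL4, hnt⟩

/-! ## §0 The crux decides the sub-problem by landed theorems -/

/-- X ⊢ ¬S: `closes` with its two other binders discharged by landed proofs. -/
theorem crux_decides : QuantisedSymmetry.PolyhedralDssProfileExists → ¬ _root_.NavierStokesRegularity :=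
  fun hX => QuantisedSymmetry.closes hX quantisedSymmetry_polyhedralTruncationBridge_proof
    QuantisedSymmetry.ClayUniqueness_holds

/-! ## §1 Summit-down: the on-path weaker intermediates all decide ¬S themselves -/

/-- X ⇒ W₁ (plain Type-I λ-DSS profile, stmt-0155; landed `stub_dominatesBlowupProfile`). -/
theorem crux_implies_W1 : QuantisedSymmetry.PolyhedralDssProfileExists → Blowup.BlowupTypeIDssProfile :=
  stub_dominatesBlowupProfile

/-- X5a ⊢ ¬S (route Blowup's `closes` with the proved `BlowupClayUniqueness`). -/
theorem X5a_decides : Blowup.BlowupExists → ¬ _root_.NavierStokesRegularity :=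
  fun h => Blowup.closes h Blowup.BlowupClayUniqueness_holds

/-- W₁ ⇒ X5a by the landed rotated truncation bridge `filamentSkeletonRss_rdssProfileTruncation_proof`. -/
theorem W1_implies_X5a : Blowup.BlowupTypeIDssProfile → Blowup.BlowupExists := by
  intro hW
  by_contra hno
  apply hW
  intro c
  refine ⟨?_, fun R => ?_⟩
  · intro hc u hanc hmeas hdss hdec
    by_contra hnt
    exact hno (filamentSkeletonRss_rdssProfileTruncation_proof
      ⟨c, LinearIsometryEquiv.refl ℝ (EuclideanSpace ℝ (Fin 3)), u, hc, hanc, hmeas,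
        isRotatedDSS_refl_iff.mpr hdss, hdec, hnt⟩)
  · intro hc u hanc hmeas hrdss hdec
    by_contra hnt
    exact hno (filamentSkeletonRss_rdssProfileTruncation_proof ⟨c, R, u, hc, hanc, hmeas, hrdss, hdec, hnt⟩)

/-- W₁ ⊢ ¬S: the nearest strictly weaker on-path intermediate is itself summit-deciding. -/
theorem W1_decides : Blowup.BlowupTypeIDssProfile → ¬ _root_.NavierStokesRegularity :=
  fun h => X5a_decides (W1_implies_X5a h)

/-- W_rot: a nontrivial Type-I ROTATED-λ-DSS ancient mild profile (antecedent of `FilamentSkeletonRss.RdssProfileTruncation`). -/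
def WRot : Prop :=
  ∃ (c : ℝ) (R : EuclideanSpace ℝ (Fin 3) ≃ₗᵢ[ℝ] EuclideanSpace ℝ (Fin 3))
    (u : ℝ → EuclideanSpace ℝ (Fin 3) → EuclideanSpace ℝ (Fin 3)), 1 < c ∧ IsAncientMildSolution 1 u ∧
    (∀ t < 0, AEStronglyMeasurable (u t) volume) ∧ IsRotatedDSS c R u ∧ (∃ C₀ : ℝ, HasTypeIDecay C₀ u) ∧
    ¬ (∀ t < 0, u t =ᵐ[volume] 0)

/-- X ⇒ W_rot (forget `G`, take the trivial rotation). -/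
theorem crux_implies_WRot : QuantisedSymmetry.PolyhedralDssProfileExists → WRot := by
  rintro ⟨G, -, -, -, c, hc, u, hanc, hmeas, hdss, hdec, -, hnt⟩
  exact ⟨c, LinearIsometryEquiv.refl ℝ (EuclideanSpace ℝ (Fin 3)), u, hc, hanc, hmeas,
    isRotatedDSS_refl_iff.mpr hdss, hdec, hnt⟩

/-- W_rot ⊢ ¬S (landed bridge + Blowup glue). -/
theorem WRot_decides : WRot → ¬ _root_.NavierStokesRegularity :=
  fun h => X5a_decides (filamentSkeletonRss_rdssProfileTruncation_proof h)

/-! ## §2 Off-path weakenings and the decomposition `D_bdd` -/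

/-- W_TypeI := ¬ (kill switch #1405): some `G`-equivariant Type-I bounded ancient mild solution is nontrivial
(no self-similarity of any kind). Weaker than X, feeds no bridge. -/
def WTypeI : Prop := ¬ QuantisedSymmetry.PolyhedralTypeILiouville

/-- X ⇒ W_TypeI (landed glue `quantisedSymmetry_liouvilleKillsProfile_proof`, item 1408). -/
theorem crux_implies_WTypeI : QuantisedSymmetry.PolyhedralDssProfileExists → WTypeI :=
  fun hX hL => quantisedSymmetry_liouvilleKillsProfile_proof hL hX

/-- W_bdd: a nontrivial bounded continuous `G`-cell WITHOUT the `L⁴` (spatial decay) datum condition. -/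
def WBdd : Prop :=
  ∃ G : Subgroup (EuclideanSpace ℝ (Fin 3) ≃ₗᵢ[ℝ] EuclideanSpace ℝ (Fin 3)), IsPolyhedral G ∧
    ∃ c : ℝ, 1 < c ∧ ∃ v : ℝ → EuclideanSpace ℝ (Fin 3) → EuclideanSpace ℝ (Fin 3),
      IsCell G c v ∧ ¬ (v (-1) =ᵐ[volume] 0)

/-- X ⇒ W_bdd (landed `stub_cellOfProfile`, dropping `L⁴`). -/
theorem crux_implies_WBdd : QuantisedSymmetry.PolyhedralDssProfileExists → WBdd := by
  intro hX
  obtain ⟨G, hG, c, hc, v, hcell, -, hnt⟩ := crux_iff_cell.mp hX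
  exact ⟨G, hG, c, hc, v, hcell, hnt⟩

/-- The upgrade piece of `D_bdd`: every nontrivial bounded polyhedral cell has an `L⁴` datum (a spatial-decay /
Liouville-type statement: "no off-centre singular rays"). -/
def BddUpgrade : Prop :=
  ∀ G : Subgroup (EuclideanSpace ℝ (Fin 3) ≃ₗᵢ[ℝ] EuclideanSpace ℝ (Fin 3)), IsPolyhedral G →
    ∀ c : ℝ, 1 < c → ∀ v : ℝ → EuclideanSpace ℝ (Fin 3) → EuclideanSpace ℝ (Fin 3),
      IsCell G c v → ¬ (v (-1) =ᵐ[volume] 0) → MemLp (v (-1)) 4 volume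

/-- `D_bdd` assembly (proved): W_bdd → BddUpgrade → X. -/
theorem crux_of_WBdd_upgrade : WBdd → BddUpgrade → QuantisedSymmetry.PolyhedralDssProfileExists := by
  rintro ⟨G, hG, c, hc, v, hcell, hnt⟩ hup
  exact crux_iff_cell.mpr ⟨G, hG, c, hc, v, hcell, hup G hG c hc v hcell hnt, hnt⟩

/-! ## §3 The Newton–Kantorovich (computer-assisted) decomposition `D_NK` -/

/-- The classical Newton–Kantorovich theorem (Kantorovich 1948; Ortega, Amer. Math. Monthly 75 (1968) 658), in
norm form: `‖F'(a)⁻¹‖ ≤ K`, `‖F a‖ ≤ ε`, `F'` `L`-Lipschitz on `B̄(a,r)`, `2K²Lε ≤ 1`, `2Kε ≤ r` ⇒ a zero in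
`B̄(a, 2Kε)`. A KNOWN theorem (support-grade, not in Mathlib). -/
def NewtonKantorovich : Prop :=
  ∀ (E : Type) [NormedAddCommGroup E] [NormedSpace ℝ E] [CompleteSpace E]
    (F : E → E) (F' : E → (E →L[ℝ] E)) (A : E ≃L[ℝ] E) (a : E) (r K L ε : ℝ),
    0 ≤ ε → 0 ≤ K → 0 ≤ L → 2 * K * ε ≤ r →
    (∀ x ∈ Metric.closedBall a r, HasFDerivAt F (F' x) x) →
    (∀ x ∈ Metric.closedBall a r, ∀ y ∈ Metric.closedBall a r, ‖F' x - F' y‖ ≤ L * ‖x - y‖) →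
    (A : E →L[ℝ] E) = F' a → ‖(A.symm : E →L[ℝ] E)‖ ≤ K → ‖F a‖ ≤ ε →
    2 * (K * K * L * ε) ≤ 1 →
    ∃ x ∈ Metric.closedBall a (2 * K * ε), F x = 0

/-- `NKCertificate`: a Banach space `E` of candidate fields, a defect map `F` whose NONZERO zeros realise polyhedral
cells with `L⁴` nontrivial datum (`real`), and an approximate zero `a` with verified Kantorovich constants and the
nontriviality margin `2Kε < ‖a‖`. This is the ∃-piece: it is what a computer-assisted proof would have to supply. -/
def NKCertificate : Prop :=
  ∃ (E : Type) (_ : NormedAddCommGroup E) (_ : NormedSpace ℝ E) (_ : CompleteSpace E)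
    (F : E → E) (F' : E → (E →L[ℝ] E)) (A : E ≃L[ℝ] E) (a : E) (r K L ε : ℝ)
    (real : E → ℝ → EuclideanSpace ℝ (Fin 3) → EuclideanSpace ℝ (Fin 3))
    (G : Subgroup (EuclideanSpace ℝ (Fin 3) ≃ₗᵢ[ℝ] EuclideanSpace ℝ (Fin 3))) (c : ℝ),
    IsPolyhedral G ∧ 1 < c ∧
    (∀ x : E, F x = 0 → x ≠ 0 →
      IsCell G c (real x) ∧ MemLp (real x (-1)) 4 volume ∧ ¬ (real x (-1) =ᵐ[volume] 0)) ∧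
    0 ≤ ε ∧ 0 ≤ K ∧ 0 ≤ L ∧ 2 * K * ε ≤ r ∧
    (∀ x ∈ Metric.closedBall a r, HasFDerivAt F (F' x) x) ∧
    (∀ x ∈ Metric.closedBall a r, ∀ y ∈ Metric.closedBall a r, ‖F' x - F' y‖ ≤ L * ‖x - y‖) ∧
    (A : E →L[ℝ] E) = F' a ∧ ‖(A.symm : E →L[ℝ] E)‖ ≤ K ∧ ‖F a‖ ≤ ε ∧ 2 * (K * K * L * ε) ≤ 1 ∧
    2 * K * ε < ‖a‖

/-- `D_NK` assembly (proved): certificate + Newton–Kantorovich ⇒ X. -/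
theorem crux_of_certificate : NKCertificate → NewtonKantorovich → QuantisedSymmetry.PolyhedralDssProfileExists := by
  rintro ⟨E, _, _, _, F, F', A, a, r, K, L, ε, real, G, c, hG, hc, hreal, hε, hK, hL, hr, hder, hlip, hA, hAinv,
    hFa, hNKineq, hmargin⟩ hNK
  obtain ⟨x, hx, hFx⟩ := hNK E F F' A a r K L ε hε hK hL hr hder hlip hA hAinv hFa hNKineq
  have hx0 : x ≠ 0 := by
    rintro rfl
    have h1 : ‖a‖ ≤ 2 * K * ε := by
      have := Metric.mem_closedBall.mp hx
      rwa [dist_eq_norm, zero_sub, norm_neg] at this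
    exact absurd hmargin (not_lt.mpr h1)
  obtain ⟨hcell, hL4, hnt⟩ := hreal x hFx hx0
  exact crux_iff_cell.mpr ⟨G, hG, c, hc, real x, hcell, hL4, hnt⟩

/-! ## §4 Strengthening: a whole branch of cells parametrised by the factor -/

/-- S⁺ (continuation shape): ONE polyhedral group carrying a nontrivial `L⁴` cell for EVERY factor `c > 1`. -/
def BranchInC : Prop :=
  ∃ G : Subgroup (EuclideanSpace ℝ (Fin 3) ≃ₗᵢ[ℝ] EuclideanSpace ℝ (Fin 3)), IsPolyhedral G ∧
    ∀ c : ℝ, 1 < c → ∃ v : ℝ → EuclideanSpace ℝ (Fin 3) → EuclideanSpace ℝ (Fin 3),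
      IsCell G c v ∧ MemLp (v (-1)) 4 volume ∧ ¬ (v (-1) =ᵐ[volume] 0)

/-- S⁺ ⇒ X (specialise the branch at `c = 2`). -/
theorem crux_of_branch : BranchInC → QuantisedSymmetry.PolyhedralDssProfileExists := by
  rintro ⟨G, hG, hbranch⟩
  obtain ⟨v, hcell, hL4, hnt⟩ := hbranch 2 (by norm_num)
  exact crux_iff_cell.mpr ⟨G, hG, 2, by norm_num, v, hcell, hL4, hnt⟩

/-! ## §5 Negation side: the only typed engine is the kill switch itself -/

/-- ¬X ⇐ kill switch #1405 (landed glue `LiouvilleKillsProfile`, item 1408). -/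
theorem negation_is_killSwitch :
    QuantisedSymmetry.PolyhedralTypeILiouville → ¬ QuantisedSymmetry.PolyhedralDssProfileExists :=
  fun hL hX => quantisedSymmetry_liouvilleKillsProfile_proof hL hX

/-- Landed partial exclusions referenced in the census (names certified to exist). -/
example := @stub_noSmallCell
example := @stub_noSmallConstant
example := @stub_noWeakHealing

end

end Summit.NavierStokesRegularity.NavierStokesRegularity.Cruxes.PolyhedralDssProfileExists.StrategistS18g8
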